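import Literature.AlgebraicGeometry.Resolution.ProjectiveModelsDomination
import Literature.AlgebraicGeometry.Resolution.ProjectiveResolutionProofs
import Literature.AlgebraicGeometry.Resolution.BaseChangeOverOpens
import Literature.AlgebraicGeometry.Motives.PullbackOver
import Literature.AlgebraicGeometry.Motives.VarietiesGeometricallyIntegralProofs
import Literature.AlgebraicGeometry.Motives.CartierDivisor
import Literature.AlgebraicGeometry.Motives.Varieties
import HarnessLib

/-!
# Resolving the rational map `τ⁻¹ ∘ g : V ⇢ W` by a smooth projective model

Topic: `Literature/AlgebraicGeometry/Resolution`. Let `g : V → X` and `τ : W → X` be morphisms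
of smooth projective complex varieties sending the generic point `η` of `V` and a point `ω` of
`W` to the same point `z` of `X`, such that `κ(z) → κ(ω)` is surjective (e.g. `ω` the generic
point of `W` and `τ` birational onto the common image `closure {z}`). Then the rational map
`τ⁻¹ ∘ g : V ⇢ W` is resolved by a smooth projective `T`: there are `p : T → V` birational and
`q : T → W` with `p ≫ g = q ≫ τ` (Hartshorne II, Example 7.17.3 — elimination of the
indeterminacy of a rational map by passing to the closure of its graph — followed by Hironaka's
resolution of that closure). PROVED:

* `exists_isSmoothProjective_isBirational_comp_eq_of_residueFieldMap_surjective`.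

The proof is the JOIN of models (Zariski–Samuel II, Ch. VI §17): with `K = K(V) = 𝒪_{V,η}`,
`V` is a projective model of `K/ℂ` (`ProjModel`); since `Spec K → V → X` lands in `z` it
factors through `Spec κ(z) ≅ Spec κ(ω) → W`, a `K`-point `y` of `W` over `X`; the
scheme-theoretic image `N` of the `K`-point `(gen_V, y)` of `V ×_X W` (projective: a closed
subscheme of `V ×_ℂ W`, `X` being separated) is a projective model of `K/ℂ` dominating `V`
(`ProjModel.ofClosure`, `ProjModel.ofClosure.homOf`), so `N → V` is birational
(`ProjModel.Hom.isBirational`); Hironaka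
(`exists_isSmoothProjective_isBirational_of_isProjectiveOver`) resolves `N` by a smooth
projective `T → N` birational, and `T → N ⊆ V ×_X W ⇉ V, W` are `p` and `q`.

## References

* R. Hartshorne, *Algebraic Geometry* (1977), II Example 7.17.3. [Hartshorne1977]
* H. Hironaka, *Resolution of singularities of an algebraic variety over a field of
  characteristic zero*, Ann. of Math. 79 (1964), Main Theorem I. [Hironaka1964]
* O. Zariski, P. Samuel, *Commutative Algebra* II (1960), Ch. VI §17 (joins of models).
  [ZariskiSamuel1960]
-/

noncomputable section

open CategoryTheory CategoryTheory.Limits AlgebraicGeometry Order IsLocalRing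

namespace Literature.AlgebraicGeometry.Resolution

open Literature.AlgebraicGeometry Literature.AlgebraicGeometry.Motives

universe u

/-- A `K`-point `f : Spec K → X` of a scheme factors through `Spec κ(x) → X` for any point `x`
equal to its image (Mathlib's `Scheme.SpecToEquivOfField`, transported along `f(pt) = x`).
[folklore] -/
theorem exists_specMap_comp_fromSpecResidueField_eq {X : Scheme.{u}} {K : Type u} [Field K]
    (f : Spec (.of K) ⟶ X) {x : X} (hx : f (closedPoint K) = x) :
    ∃ α : X.residueField x ⟶ .of K, Spec.map α ≫ X.fromSpecResidueField x = f := by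
  subst hx
  exact ⟨_, Scheme.descResidueField_stalkClosedPointTo_fromSpecResidueField K X f⟩

/-- **Resolving the rational map `τ⁻¹ ∘ g` by a smooth projective model** (Hartshorne II,
Example 7.17.3, with Hironaka 1964, Main Theorem I, for the smoothness; the closure of the graph
is the join of models of Zariski–Samuel II, Ch. VI §17). For morphisms `g : V → X`, `τ : W → X`
of smooth projective complex varieties, `η` the generic point of `V` and `ω` a point of `W` with
`g η = τ ω` and `κ(τ ω) → κ(ω)` surjective, there is a smooth projective `T` with `p : T → V`
birational and `q : T → W` such that `p ≫ g = q ≫ τ`.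
[cite: Hartshorne1977, II Example 7.17.3] [cite: Hironaka1964, Main Theorem I]
[cite: ZariskiSamuel1960, Ch. VI §17] -/
theorem exists_isSmoothProjective_isBirational_comp_eq_of_residueFieldMap_surjective :
    ∀ ⦃n d : ℕ⦄ ⦃X V W : Motives.SchemeOver ℂ⦄ (hX : Motives.IsSmoothProjective n X)
      (hV : Motives.IsSmoothProjective d V) (hW : Motives.IsSmoothProjective d W)
      (g : V ⟶ X) (τ : W ⟶ X) ⦃η : V.left⦄ ⦃ω : W.left⦄,
      IsGenericPoint η Set.univ → IsGenericPoint ω Set.univ →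
      g.left.base η = τ.left.base ω → Function.Surjective (τ.left.residueFieldMap ω) →
      ∃ (T : Motives.SchemeOver ℂ) (d' : ℕ) (_ : Motives.IsSmoothProjective d' T) (p : T ⟶ V)
        (q : T ⟶ W), p ≫ g = q ≫ τ ∧ Resolution.IsBirational p.left := by
  intro n d X V W hX hV hW g τ η ω hη _hω hz hsurj
  haveI : IsIntegral V.left := IsSmoothProjective.isIntegral_holds hV
  haveI : IsProper X.hom := IsSmoothProjective.isProper_holds hX
  obtain rfl : η = genericPoint V.left := hη.eq (genericPoint_spec V.left)
  /- (1) `V` as a projective model of its function field `K = 𝒪_{V,η}` -/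
  letI : Algebra ℂ V.left.functionField := RatFn.algebraStalk ℂ (genericPoint V.left)
  have hgenV : V.left.fromSpecStalk (genericPoint V.left) ≫ V.hom =
      Spec.map (CommRingCat.ofHom (algebraMap ℂ V.left.functionField)) := by
    have h1 : V.hom =
        V.left.toSpecΓ ≫ Spec.map ((Scheme.ΓSpecIso (.of ℂ)).inv ≫ V.hom.appTop) := by
      rw [Spec.map_comp, ← Scheme.toSpecΓ_naturality_assoc, toSpecΓ_SpecMap_ΓSpecIso_inv,
        Category.comp_id]
    rw [h1, Scheme.fromSpecStalk_toSpecΓ_assoc, ← Spec.map_comp]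
    rfl
  let MV : ProjModel ℂ V.left.functionField :=
    { X := V.left
      π := V.hom
      gen := V.left.fromSpecStalk (genericPoint V.left)
      gen_π := hgenV
      isIntegral := inferInstance
      isProjectiveOver := hV.isProjectiveOver
      genericPt_eq := Scheme.fromSpecStalk_closedPoint
      isIso_stalkClosedPointTo := by
        rw [Scheme.stalkClosedPointTo_fromSpecStalk]
        infer_instance }
  /- (2) the `K`-point `y` of `W`: `Spec K → V → X` lands in `g η = τ ω`, so it factors through
  `Spec κ(τ ω) ≅ Spec κ(ω) → W` -/
  have hpt : (V.left.fromSpecStalk (genericPoint V.left) ≫ g.left)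
      (closedPoint V.left.functionField) = τ.left.base ω := by
    rw [Scheme.Hom.comp_apply, Scheme.fromSpecStalk_closedPoint]
    exact hz
  obtain ⟨α, hα⟩ := exists_specMap_comp_fromSpecResidueField_eq _ hpt
  haveI : IsIso (τ.left.residueFieldMap ω) :=
    (ConcreteCategory.isIso_iff_bijective _).mpr
      ⟨(τ.left.residueFieldMap ω).hom.injective, hsurj⟩
  let y : Spec (.of V.left.functionField) ⟶ W.left :=
    Spec.map (inv (τ.left.residueFieldMap ω) ≫ α) ≫ W.left.fromSpecResidueField ω
  have hy : V.left.fromSpecStalk (genericPoint V.left) ≫ g.left = y ≫ τ.left := by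
    rw [← hα]
    simp only [y, Category.assoc]
    rw [← Scheme.Hom.SpecMap_residueFieldMap_fromSpecResidueField, ← Spec.map_comp_assoc,
      IsIso.hom_inv_id_assoc]
  /- (3) the closure `N` of the `K`-point `(gen_V, y)` of `V ×_X W` (projective over `ℂ`): a
  projective model of `K` dominating `V`, hence birational over `V` -/
  let Q : Motives.SchemeOver ℂ := Motives.pullbackOver g τ
  have hQ : Motives.IsProjectiveOver Q :=
    isProjectiveOver_of_isClosedImmersion_left (Motives.pullbackOver.toProd g τ)
      (hV.isProjectiveOver.tensor hW.isProjectiveOver)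
  let rl : Spec (.of V.left.functionField) ⟶ Q.left :=
    pullback.lift (V.left.fromSpecStalk (genericPoint V.left)) y hy
  have hr : rl ≫ pullback.fst g.left τ.left = MV.gen := pullback.lift_fst _ _ _
  have hs : pullback.fst g.left τ.left ≫ MV.π = Q.hom := rfl
  let N : ProjModel ℂ V.left.functionField :=
    ProjModel.ofClosure MV hQ rl (pullback.fst g.left τ.left) hs hr
  let φ : N.Hom MV :=
    ProjModel.ofClosure.homOf MV hQ rl (pullback.fst g.left τ.left) hs hr MV
      (pullback.fst g.left τ.left) hs hr
  -- forget how `N` was built: an integral `Z`, projective over `ℂ`, with `Z → V ×_X W → V`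
  -- birational
  obtain ⟨Z, hZi, c, hZp, hbir⟩ : ∃ (Z : Scheme) (_ : IsIntegral Z)
      (c : Z ⟶ pullback g.left τ.left),
      Motives.IsProjectiveOver
          (Over.mk (c ≫ pullback.fst g.left τ.left ≫ V.hom) : Motives.SchemeOver ℂ) ∧
        IsBirational (c ≫ pullback.fst g.left τ.left) :=
    ⟨N.X, N.isIntegral, rl.imageι, N.isProjectiveOver, φ.isBirational⟩
  /- (4) Hironaka -/
  haveI : IsIntegral
      (Over.mk (c ≫ pullback.fst g.left τ.left ≫ V.hom) : Motives.SchemeOver ℂ).left := hZi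
  obtain ⟨d', T, π, hT, hπ, -⟩ :=
    exists_isSmoothProjective_isBirational_of_isProjectiveOver
      (Over.mk (c ≫ pullback.fst g.left τ.left ≫ V.hom)) hZp
  /- (5) the output `T → Z → V ×_X W ⇉ V, W` -/
  have hVW : pullback.snd g.left τ.left ≫ W.hom = pullback.fst g.left τ.left ≫ V.hom := by
    rw [← Over.w τ, ← Over.w g, pullback.condition_assoc]
  have hw : (π.left ≫ c ≫ pullback.fst g.left τ.left) ≫ V.hom = T.hom := by
    rw [← Over.w π]
    simp only [Category.assoc]
    rfl
  have hw' : (π.left ≫ c ≫ pullback.snd g.left τ.left) ≫ W.hom = T.hom := by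
    rw [← hw]
    simp only [Category.assoc, hVW]
  refine ⟨T, d', hT, Over.homMk (π.left ≫ c ≫ pullback.fst g.left τ.left) hw,
    Over.homMk (π.left ≫ c ≫ pullback.snd g.left τ.left) hw', ?_, ?_⟩
  · ext : 1
    show (π.left ≫ c ≫ pullback.fst g.left τ.left) ≫ g.left =
      (π.left ≫ c ≫ pullback.snd g.left τ.left) ≫ τ.left
    simp only [Category.assoc, pullback.condition]
  · exact hπ.comp hbir

end Literature.AlgebraicGeometry.Resolution

end
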